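import HarnessLib
import Summits.RiemannHypothesis.RiemannHypothesis.Theorems.SignConePointwiseCheckerSound

/-!
# Route SignCone: the fast pointwise-certificate checker (tables, anchors, two-point cells) — definitions

Support for the unconditional rungs of `SignConeOscillatory` / `SignConeInequality`
(items stmt-RiemannHypothesis-16302 / 16301). A faster kernel evaluation for the SAME certificate
format `PWData` and the same density `F_D` (`SignConePointwiseCheckerDefs.lean`), for the larger
cut-offs where the grids reach `Y₀` in the hundreds:

* the certified lower bound `wLoQ` of `Re ψ(1/4 + iu/2)` (a long series) is evaluated once per grid
  chunk, at its first point (the ANCHOR), instead of once per cell — `Re ψ(1/4 + iy/2)` is monotone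
  in `|y|` (`reDigammaQuarter_mono`);
* the knot data `(cosh(x_k/2), sinh(x_k/2))` and the logarithms `log n` are read from tables
  `cs`, `logs` supplied with the certificate and checked ONCE against the engine (`tablesOK`);
* the knot values `T(x_k, u)` are produced in one pass (`PW.tfiList`, running product
  `e^{i x_k u} = e^{iLu}(e^{ihu})^k`) and `Ê_χ(u)` is folded over them with a sliding window
  (`PW.sdSum`, `PW.ehatFromList`);
* TWO-POINT CELLS: with the certified point bounds `f_u`, `f_v` (no slope term) at consecutive
  grid points, `F_D(y) ≥ f_u − S(y − u)` and `F_D(y) ≥ f_v − S(v − y)` on `[u, v]` add up to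
  `2 F_D(y) ≥ f_u + f_v − S(v − u)`, so a cell passes when `S(v − u) ≤ f_u + f_v` — twice the
  width of the one-sided cells of `SignConePointwiseCheckerDefs.lean`, each point bound computed once.

This file: `PW.cbMulList`, `PW.tfiList`, `PW.sdSum`, `PW.ehatFromList`, `PW.combFIT` (+ membership
lemmas) and the computable checks `PWData.tablesOK / flT / checkGridFrom / checkGrid₂ / checkAGrid₂`.
Soundness (`PWData.F_nonneg_of_checks₂`) is in `SignConePointwiseCheckerFastSound.lean`.
-/

noncomputable section

-- `Summit.RiemannHypothesis.RiemannHypothesis.…` repeats a namespace component by design (D-0017 layout).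
set_option linter.dupNamespace false

open Real

namespace Summit.RiemannHypothesis.RiemannHypothesis.Theorems.SignCone

open Literature.Analysis.ValidatedNumerics.Numerics Literature.NumberTheory.LFunctions
open Literature.Analysis.SpecialFunctions (reDigammaQuarter reDigammaQuarter_mono reDigammaQuarter_even)

namespace PW

/-! ## One-pass knot values, `Ê_χ` by a sliding window, the comb from a log table -/

/-- `[Z, Z·W, Z·W², …]` with `n` entries (running products). [folklore] -/
def cbMulList (W : CB) : CB → ℕ → List CB
  | _, 0 => []
  | Z, n + 1 => Z :: cbMulList W (CB.mul Z W) n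

/-- `z w^k ∈ (cbMulList W Z n)[k]` for `k < n`. [folklore] -/
theorem mem_cbMulList_getD {w : ℂ} {W : CB} (hw : CB.mem w W) :
    ∀ (n : ℕ) (z : ℂ) (Z : CB) (k : ℕ), CB.mem z Z → k < n →
      CB.mem (z * w ^ k) ((cbMulList W Z n).getD k (CB.ofInt 0))
  | 0, _, _, _, _, hk => absurd hk (Nat.not_lt_zero _)
  | n + 1, z, Z, 0, hz, _ => by simpa [cbMulList] using hz
  | n + 1, z, Z, k + 1, hz, hk => by
    have ih := mem_cbMulList_getD hw n (z * w) (CB.mul Z W) k (CB.mem_mul hz hw) (by omega)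
    simp only [cbMulList, List.getD_cons_succ]
    convert ih using 1
    ring

/-- The knot values `[T(x_0, u), T(x_1, u), …]` in one pass over the knot table `cs`
(`cs[k] ∋ (cosh(x_k/2), sinh(x_k/2))`), with the running product `Z_k = Z₀ W^k ∋ e^{i x_k u}`. [folklore] -/
def tfiList (u : ℚ) (W : CB) : List (FI × FI) → CB → List FI
  | [], _ => []
  | c :: rest, Z => TFI c.1 c.2 Z u :: tfiList u W rest (CB.mul Z W)

/-- Length of `tfiList`. [folklore] -/
theorem length_tfiList (u : ℚ) (W : CB) : ∀ (cs : List (FI × FI)) (Z : CB),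
    (tfiList u W cs Z).length = cs.length
  | [], _ => rfl
  | c :: rest, Z => by simp [tfiList, length_tfiList u W rest]

/-- **Soundness of `tfiList`**: if `cs[j] ∋ (cosh(x/2), sinh(x/2))` and `e^{ixu} = z w^j` with
`z ∈ Z`, `w ∈ W`, then `T(x, u) ∈ (tfiList u W cs Z)[j]`. [folklore] -/
theorem mem_tfiList_getD {u : ℚ} {w : ℂ} {W : CB} (hw : CB.mem w W) :
    ∀ (cs : List (FI × FI)) (Z : CB) (z : ℂ), CB.mem z Z → ∀ j < cs.length, ∀ x : ℝ,
      FI.mem (Real.cosh (x / 2)) (cs.getD j (FI.ofInt 0, FI.ofInt 0)).1 →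
      FI.mem (Real.sinh (x / 2)) (cs.getD j (FI.ofInt 0, FI.ofInt 0)).2 →
      Complex.exp (((x * u : ℝ)) * Complex.I) = z * w ^ j →
      FI.mem (pwT x u) ((tfiList u W cs Z).getD j (FI.ofInt 0))
  | [], _, _, _, j, hj, _, _, _, _ => absurd hj (Nat.not_lt_zero _)
  | c :: rest, Z, z, hz, 0, _, x, hC, hS, he => by
    simp only [List.getD_cons_zero] at hC hS
    simp only [tfiList, List.getD_cons_zero]
    refine mem_TFI hC hS ?_
    rw [he, pow_zero, mul_one]
    exact hz
  | c :: rest, Z, z, hz, j + 1, hj, x, hC, hS, he => by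
    simp only [List.getD_cons_succ] at hC hS
    simp only [tfiList, List.getD_cons_succ]
    refine mem_tfiList_getD hw rest (CB.mul Z W) (z * w) (CB.mem_mul hz hw) j
      (by simp only [List.length_cons] at hj; omega) x hC hS ?_
    rw [he]; ring

/-- Sliding-window sum `Σ_{i = k}^{k + |rest| - 1} χ_i (t_{i-1} − 2 t_i + t_{i+1})` over the list of
knot values (`A = t_{k-1}`, `B = t_k`, `rest = [t_{k+1}, …]`). [folklore] -/
def sdSum (chi : ℕ → ℚ) : ℕ → FI → FI → List FI → FI
  | _, _, _, [] => FI.ofInt 0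
  | k, A, B, C :: rest =>
    ((FI.ofRat (chi k)).mul ((A.sub ((FI.ofRat 2).mul B)).add C)).add (sdSum chi (k + 1) B C rest)

/-- **Soundness of `sdSum`.** [folklore] -/
theorem mem_sdSum (chi : ℕ → ℚ) (g : ℕ → ℝ) : ∀ (rest : List FI) (k : ℕ) (A B : FI),
    FI.mem (g (k - 1)) A → FI.mem (g k) B →
    (∀ j < rest.length, FI.mem (g (k + 1 + j)) (rest.getD j (FI.ofInt 0))) →
    FI.mem (∑ i ∈ Finset.Ico k (k + rest.length), (chi i : ℝ) * (g (i - 1) - 2 * g i + g (i + 1)))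
      (sdSum chi k A B rest)
  | [], k, A, B, _, _, _ => by simpa [sdSum] using FI.mem_ofInt 0
  | C :: rest, k, A, B, hA, hB, hr => by
    have hC : FI.mem (g (k + 1)) C := by simpa using hr 0 (by simp)
    have ih := mem_sdSum chi g rest (k + 1) B C (by simpa using hB) hC (fun j hj => by
      have := hr (j + 1) (by simp only [List.length_cons]; omega)
      simp only [List.getD_cons_succ] at this
      convert this using 2; ring)
    simp only [List.length_cons]
    rw [Finset.sum_eq_sum_Ico_succ_bot (by omega), show k + (rest.length + 1) = k + 1 + rest.length by ring]
    simp only [sdSum]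
    refine FI.mem_add ?_ ih
    have := FI.mem_mul (FI.mem_ofRat (chi k)) (FI.mem_add (FI.mem_sub hA (FI.mem_mul (FI.mem_ofRat 2) hB)) hC)
    convert this using 1; push_cast; ring

/-- `Ê_χ(u)` from the list of knot values `[t_0, …, t_K]`:
`4[(t₁ − t₀)/h + (Σ_{1 ≤ k < K} χ_k (t_{k−1} − 2t_k + t_{k+1}))/h]` (junk on short lists). [folklore] -/
def ehatFromList (d : PWKernel) : List FI → FI
  | t0 :: t1 :: rest =>
    (FI.ofRat 4).mul (((t1.sub t0).mul (FI.ofRat (1 / d.h))).add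
      ((sdSum d.chiAt 1 t0 t1 rest).mul (FI.ofRat (1 / d.h))))
  | _ => FI.ofInt 0

/-- **Soundness of `ehatFromList`**: `ehatCF d u ∈ ehatFromList d ts` when `ts` has length `K + 1`
and `T(x_k, u) ∈ ts[k]` for `k ≤ K`. [folklore] -/
theorem mem_ehatFromList (d : PWKernel) {ts : List FI} {u : ℚ} (hlen : ts.length = d.K + 1)
    (hT : ∀ k ≤ d.K, FI.mem (pwT (d.knot k) u) (ts.getD k (FI.ofInt 0))) :
    FI.mem (d.ehatCF u) (ehatFromList d ts) := by
  have hK : 1 ≤ d.K := Nat.succ_le_of_lt (Nat.succ_pos _)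
  match ts, hlen, hT with
  | [], hlen, _ => simp at hlen
  | [_], hlen, _ => simp at hlen; omega
  | t0 :: t1 :: rest, hlen, hT =>
    have h0 : FI.mem (pwT (d.knot 0) u) t0 := by simpa using hT 0 (Nat.zero_le _)
    have h1 : FI.mem (pwT (d.knot 1) u) t1 := by simpa using hT 1 hK
    have hrl : rest.length = d.K - 1 := by simp only [List.length_cons] at hlen; omega
    have hs := mem_sdSum d.chiAt (fun i => pwT (d.knot i) u) rest 1 t0 t1 (by simpa using h0) h1
      (fun j hj => by
        have := hT (1 + 1 + j) (by omega)
        simpa [List.getD_cons_succ, show 1 + 1 + j = j + 1 + 1 by ring] using this)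
    rw [hrl, show 1 + (d.K - 1) = d.K by omega] at hs
    unfold ehatFromList PWKernel.ehatCF
    have := FI.mem_mul (FI.mem_ofRat 4) (FI.mem_add (FI.mem_mul (FI.mem_sub h1 h0) (FI.mem_ofRat (1 / d.h)))
      (FI.mem_mul hs (FI.mem_ofRat (1 / d.h))))
    convert this using 1
    push_cast
    rw [Finset.sum_mul]
    congr 1
    congr 1
    · ring
    · refine Finset.sum_congr rfl fun i _ => ?_
      ring

/-- Enclosure of `Σ_{n ∈ l} a(n) cos(u log n)` with the logarithms read from a table `logs`
(`logs = FI.logTable N` in use). [folklore] -/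
def combFIT (l : List ℕ) (a : ℕ → ℚ) (logs : List FI) (u : ℚ) : FI :=
  l.foldr (fun n acc => ((FI.ofRat (a n)).mul (FI.cosSin ((FI.ofRat u).mul (logs.getD n (FI.ofInt 0)))).1).add acc)
    (FI.ofInt 0)

/-- With the engine's table the tabled comb IS the engine's comb. [folklore] -/
theorem combFIT_logTable (l : List ℕ) (a : ℕ → ℚ) (N : ℕ) (u : ℚ) :
    combFIT l a (FI.logTable N) u = combFI l a N u := rfl

end PW

namespace PWData

section Defs

variable (D : PWData)

/-- **Table check**: `cs` is the engine's knot table `[(cosh(x_k/2), sinh(x_k/2))]_{k ≤ K}` and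
`logs` its logarithm table. [folklore] -/
def tablesOK (cs : List (FI × FI)) (logs : List FI) : Bool :=
  decide (cs = (List.range (D.d.K + 1)).map D.csAt) && decide (logs = FI.logTable D.logN)

/-- The certified POINT bound `f_u = w − (log π)⁺ + s + Ê_lo(u) − comb_hi(u)` (no slope term), from
the tables and an external lower bound `w` of `Re ψ` (`none` if the engine declines). [folklore] -/
def flT (cs : List (FI × FI)) (logs : List FI) (w u : ℚ) : Option ℚ :=
  match CB.expI (FI.ofRat (D.d.L * u)), CB.expI (FI.ofRat (D.d.h * u)) with
  | some Z0, some W =>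
    some (w - logPiHi + D.s + (PW.ehatFromList D.d (PW.tfiList u W cs Z0)).loQ -
      (PW.combFIT D.nodeList D.a logs u).hiQ)
  | _, _ => none

/-- Two-point cells from the point `u` (bound `fu`) through the rest of the grid: each cell
`[u, v]` passes when `slope·(v − u) ≤ f_u + f_v`. [folklore] -/
def checkGridFrom (cs : List (FI × FI)) (logs : List FI) (w : ℚ) : ℚ → ℚ → List ℚ → Bool
  | _, _, [] => true
  | u, fu, v :: rest =>
    match D.flT cs logs w v with
    | some fv => decide (u ≤ v) && decide ((v - u) * D.slope ≤ fu + fv) && checkGridFrom cs logs w v fv rest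
    | none => false

/-- A grid passes with the common digamma bound `w` (two-point cells). [folklore] -/
def checkGrid₂ (cs : List (FI × FI)) (logs : List FI) (w : ℚ) : List ℚ → Bool
  | [] => false
  | u :: rest =>
    match D.flT cs logs w u with
    | some fu => D.checkGridFrom cs logs w u fu rest
    | none => false

/-- **An anchored grid passes**: `g = (w, u₀ :: …)` with `w ≤ wLoQ(u₀)` (certified at the anchor
`u₀` with `mwAt u₀` series terms) and the grid passing with `w`. [folklore] -/
def checkAGrid₂ (cs : List (FI × FI)) (logs : List FI) (g : ℚ × List ℚ) : Bool :=
  match g.2 with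
  | [] => false
  | u :: _ => decide (g.1 ≤ wLoQ D.prec u (D.mwAt u)) && D.checkGrid₂ cs logs g.1 g.2

end Defs

end PWData

end Summit.RiemannHypothesis.RiemannHypothesis.Theorems.SignCone

end
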